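import Summits.Ventures.LatticeQCDFlow.Scaling.SectorExactWitnessTwoSided
import Summits.Ventures.LatticeQCDFlow.Scaling.HalfSwapTightSectorLaw

/-!
HONEST FRAMING: exact (Metropolis-corrected) sampling algorithms for lattice gauge theory; figures
of merit are autocorrelation/cost numbers at stated couplings and volumes; no continuum-physics
claim.

# HalfSwapSectorExactLaw — THE HALF-SWAP CARD ON A GENERAL STATE SPACE: FOR THE QUALITY-`p` SECTOR-EXACT INSTANCE (ANY FINITE `S`, ANY
# POSITIVE LAW `ν`, ANY RARE SECTOR `A`) AT `t = ½`, `w_0 = 1`, `m = cK`: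
# `(2K/p)·log((K+1)(1−ε−K·ν(A))) ≤ t_mix(ε) ≤ ⌈(6(K+1)/p)·log((2+3K)/ε)⌉` — `Θ((K/p)·log K)`, NO `|S|`, NO `ν` (lean-2 GEN-30, ours)

Venture-side (OURS).  Cell `lqcd-flow` (pub-lqcd), unit `pub-lqcd-lean-2-g30`, 2026-08-28.  Chapter Q, file 10: the recipe card of
`Scaling/SectorExactWitnessTwoSided` in the normalisation of `Scaling/HalfSwapStarRecipe` ∕ `Scaling/HalfSwapTightSectorLaw` ∕ `Scaling/HalfSwapBooleanStarLaw`
— half of the steps swap attempts, half exact hot redraws, every cold level listed exactly `c` times.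

## What is proved

* `halfSector_constants` (at `t = ½`, `w_0 = 1`, `m = cK`: rate `≥ p/(6(K+1))`, prefactor `2 + 3K`, floor coefficient `2K/p`);
* **`halfSectorWitness_mixingTime_two_sided`** — **`(2K/p)·log((K+1)(1−ε−K·ν(A))) ≤ t_mix(ε) ≤ ⌈(6(K+1)/p)·log((2+3K)/ε)⌉`** for every finite `S`
  (`|S| ≥ 2`), positive probability vector `ν`, sector `A` (`A`, `Aᶜ` non-empty), `K ≥ 1`, `c ≥ 1`, `0 < p ≤ 1`, `0 < ε`, `ε + K·ν(A) < 1`.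

Reading (no numerics implied): the persistent flow hub with a quality-`p` proposal that is exact inside each topological sector, `K` cold replicas
with sector-confined (here idle) dynamics, half swaps: worst-start mixing in between `(2K/p)·log K` and `≈ (6K/p)·log(K/ε)` steps on ANY finite
landscape — the constants `2` and `6` apart, the volume nowhere.  NOT CLAIMED: flows inexact within a sector; anything measured.  Literature grade
(cell rule): OWN COMPOSITION; nothing cited as a fact; no new bib keys.
-/

noncomputable section

open Finset Function
open Literature.Probability.MarkovChains

namespace Summit.Ventures.LatticeQCDFlow.Scaling

variable {S : Type*} [Fintype S] [DecidableEq S] {K m : ℕ} {w : Fin (K + 1) → ℝ} {p Z : ℝ} {ν : S → ℝ}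

section HalfSector
variable (κ : Fin m → Fin K) (A : Finset S)

/-- The half-swap constants on a general `S`: with `t = ½`, `w_0 = 1`, `m = cK`, `0 < p ≤ 1`, `K, c ≥ 1`:
`1/((1/6)·min{pc/m, 1/(K+1)}) ≤ 6(K+1)/p`, the prefactor is `2 + 3K`, and `m/((1/2)·c·p) = 2K/p`. [ours] -/
theorem halfSector_constants (hK : 1 ≤ K) {c : ℕ} (hc1 : 1 ≤ c) (hmR : (m : ℝ) = c * K) (hw01 : w 0 = 1) (hp0 : 0 < p) (hp1 : p ≤ 1) :
    1 / ((1 / 2 : ℝ) * ((1 - 1 / 2) * w 0) / (2 * (1 / 2) + (1 - 1 / 2) * w 0) * min (p * c / m) (1 / (K + 1))) ≤ 6 * (K + 1) / p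
      ∧ (2 : ℝ) * (1 + K * (2 * (1 / 2) + (1 - 1 / 2) * w 0) / (2 * (1 / 2))) = 2 + 3 * K
      ∧ (m : ℝ) / (1 / 2 * c * p) = 2 * K / p := by
  have hKpos : (0 : ℝ) < K := Nat.cast_pos.mpr (by omega)
  have hcpos : (0 : ℝ) < c := Nat.cast_pos.mpr (by omega)
  rw [hw01, hmR]
  have hrate : (1 / 2 : ℝ) * ((1 - 1 / 2) * 1) / (2 * (1 / 2) + (1 - 1 / 2) * 1) = 1 / 6 := by norm_num
  rw [hrate]
  have hpcm : p * c / (c * K) = p / K := by field_simp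
  rw [hpcm]
  refine ⟨?_, by ring, by field_simp⟩
  have hmin : p / (K + 1) ≤ min (p / K) (1 / (K + 1)) := by
    refine le_min ?_ ?_
    · exact div_le_div_of_nonneg_left hp0.le hKpos (by linarith)
    · exact div_le_div_of_nonneg_right hp1 (by positivity)
  have hmin0 : 0 < min (p / (K : ℝ)) (1 / (K + 1)) := lt_min (by positivity) (by positivity)
  rw [div_le_div_iff₀ (by positivity) hp0]
  calc 1 * p = 6 * (1 / 6 * p) := by ring
    _ ≤ 6 * (1 / 6 * ((K + 1) * min (p / K) (1 / (K + 1)))) := by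
        have : p ≤ (K + 1) * min (p / (K : ℝ)) (1 / (K + 1)) := by
          calc p = (K + 1) * (p / (K + 1)) := by field_simp
            _ ≤ (K + 1) * min (p / K) (1 / (K + 1)) := mul_le_mul_of_nonneg_left hmin (by positivity)
        nlinarith
    _ = 6 * (K + 1) * (1 / 6 * min (p / K) (1 / (K + 1))) := by ring

/-- **THE HALF-SWAP CARD ON A GENERAL `S`, BOTH SIDES:** `(2K/p)·log((K+1)(1−ε−K·ν(A))) ≤ t_mix(ε) ≤ ⌈(6(K+1)/p)·log((2+3K)/ε)⌉`. [ours] -/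
theorem halfSectorWitness_mixingTime_two_sided [Nontrivial S] (hK : 1 ≤ K) {c : ℕ} (hc1 : 1 ≤ c)
    (hceq : ∀ k : Fin K, (univ.filter (fun r : Fin m => κ r = k)).card = c) (hmc : m = c * K)
    (hw0 : ∀ k, 0 ≤ w k) (hw01 : w 0 = 1) (hw1 : ∑ k, w k = 1) (hν : ∀ u, 0 < ν u) (hν1 : ∑ u, ν u = 1) (hp0 : 0 < p) (hp1 : p ≤ 1)
    (hAne : A.Nonempty) (hAc : ∃ u, u ∉ A) (hZ : Z = ∑ u, ν u * (if u ∈ A then p else 1)) {ε : ℝ} (hε0 : 0 < ε)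
    (hε : ε + K * ∑ u ∈ A, ν u < 1) :
    2 * K / p * Real.log (((K : ℝ) + 1) * (1 - ε - K * ∑ u ∈ A, ν u))
      ≤ (mixingTime (fun y z : Fin (K + 1) → S =>
          (1 / 2 : ℝ) * ptGraphSwap (fun (k : Fin (K + 1)) (u : S) => if k = 0 then ν u * (if u ∈ A then p else 1) / Z else ν u)
              (fun r : Fin m => (((0 : Fin (K + 1)), (κ r).succ) : Fin (K + 1) × Fin (K + 1))) (fun _ : Fin m => Equiv.refl S) y z
            + (1 - 1 / 2) * prodKernel w (fun (k : Fin (K + 1)) (u v : S) =>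
                if k = 0 then ν v * (if v ∈ A then p else 1) / Z else (if u = v then (1 : ℝ) else 0)) y z)
          (tensorFun (fun (k : Fin (K + 1)) (u : S) => if k = 0 then ν u * (if u ∈ A then p else 1) / Z else ν u)) ε : ℝ)
    ∧ mixingTime (fun y z : Fin (K + 1) → S =>
          (1 / 2 : ℝ) * ptGraphSwap (fun (k : Fin (K + 1)) (u : S) => if k = 0 then ν u * (if u ∈ A then p else 1) / Z else ν u)
              (fun r : Fin m => (((0 : Fin (K + 1)), (κ r).succ) : Fin (K + 1) × Fin (K + 1))) (fun _ : Fin m => Equiv.refl S) y z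
            + (1 - 1 / 2) * prodKernel w (fun (k : Fin (K + 1)) (u v : S) =>
                if k = 0 then ν v * (if v ∈ A then p else 1) / Z else (if u = v then (1 : ℝ) else 0)) y z)
          (tensorFun (fun (k : Fin (K + 1)) (u : S) => if k = 0 then ν u * (if u ∈ A then p else 1) / Z else ν u)) ε
      ≤ ⌈6 * (K + 1) / p * Real.log ((2 + 3 * K) / ε)⌉₊ := by
  obtain ⟨hm, hc, hmR⟩ := halfStarUniform_basic κ hK hc1 hceq hmc
  have hw00 : 0 < w 0 := by rw [hw01]; exact one_pos
  obtain ⟨hrate, hconst, hcoef⟩ := halfSector_constants (m := m) hK hc1 hmR hw01 hp0 hp1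
  have h := sectorWitness_mixingTime_two_sided κ A hK hm (by norm_num : (0 : ℝ) < 1 / 2) (by norm_num) hw0 hw00 hw1 hν hν1 hp0 hp1 hAne hAc
    hZ hc1 hc (cmax := c) (fun k => (hceq k).le) hε0 hε
  rw [hcoef, hconst] at h
  refine ⟨h.1, h.2.trans ?_⟩
  rcases le_or_gt 0 (Real.log ((2 + 3 * K) / ε)) with hlog | hlog
  · exact Nat.ceil_mono (mul_le_mul_of_nonneg_right hrate hlog)
  · -- a negative logarithm: the left ceiling is `0`
    have h1 : 0 < 1 / ((1 / 2 : ℝ) * ((1 - 1 / 2) * w 0) / (2 * (1 / 2) + (1 - 1 / 2) * w 0) * min (p * c / m) (1 / (K + 1))) := by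
      rw [hw01, hmR]
      have hKpos : (0 : ℝ) < K := Nat.cast_pos.mpr (by omega)
      have hcpos : (0 : ℝ) < c := Nat.cast_pos.mpr (by omega)
      have : 0 < min (p * c / (c * K : ℝ)) (1 / ((K : ℝ) + 1)) := lt_min (by positivity) (by positivity)
      positivity
    rw [Nat.ceil_eq_zero.mpr (by nlinarith)]
    exact Nat.zero_le _

end HalfSector

end Summit.Ventures.LatticeQCDFlow.Scaling

end
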